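import Mathlib
import Summits.CriticalPhenomena.Ising3DConformalLimit.Theorems.PrecisionLaplacianEtaBoundsTransferFourier
import Summits.CriticalPhenomena.Ising3DConformalLimit.Theorems.PrecisionLaplacianEtaBoundsTransferIntegral
import Literature.Probability.LatticeModels.HighDimTrivialityUniformProofs
import HarnessLib

/-!
# From block and ball sums to pointwise power bounds (Messager–Miracle-Solé transfer)

Helper file for item `stmt-CriticalPhenomena-4804`
(`Summit.CriticalPhenomena.Ising3DConformalLimit.Theses.PrecisionLaplacian.EtaBoundsTransfer`), part of its
unconditional proof: potential theory of inverse M-matrices ⇒ infinite-volume equation and Green-function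
representation; Fourier analysis on `[-π,π]^d` ⇒ block-sum upper bounds; quadratic test function ⇒ ball-sum
lower bounds; Messager–Miracle-Solé ⇒ pointwise two-sided power bounds. No definitions are introduced: the
objects (kernel matrices, box sequences, convolution powers) enter through defining hypotheses.
-/

namespace Summit.CriticalPhenomena.Ising3DConformalLimit.Theorems.EtaBoundsTransfer

open Finset Real Filter Topology MeasureTheory Literature.Probability.LatticeModels
open scoped BigOperators

section Transfer

/-- **Messager–Miracle-Solé across scales at `β_c(3)`**: `⟨σ₀σ_z⟩ ≤ ⟨σ₀σ_w⟩` whenever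
`3‖w‖_∞ ≤ ‖z‖_∞` (tree: `twoPointFree_le_of_mul_supNorm_le`, and `⟨·⟩⁺ = ⟨·⟩^f` at `β_c`). -/
theorem criticalTwoPoint_le_of_supNorm {z w : Site 3} (h : 3 * Site.supNorm w ≤ Site.supNorm z) :
    criticalTwoPoint 3 z ≤ criticalTwoPoint 3 w := by
  have hβ := criticalBeta_nonneg 3
  have h1 := twoPointFree_le_of_mul_supNorm_le (d := 3) hβ (by norm_num) h
  have heq := twoPointPlus_criticalBeta_eq_twoPointFree_holds (d := 3) (by norm_num)
  show twoPointPlus 3 (criticalBeta 3) z ≤ twoPointPlus 3 (criticalBeta 3) w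
  rw [heq z, heq w]; exact h1

/-- Differences of points of `Λ_m` lie in `Λ_{2m}`. -/
theorem sub_mem_box_two_mul {m : ℕ} {y y' : Site 3} (hy : y ∈ box 3 m) (hy' : y' ∈ box 3 m) :
    y - y' ∈ box 3 (2 * m) := by
  rw [mem_box] at hy hy' ⊢
  intro i
  have h1 := hy i; have h2 := hy' i
  simp only [Pi.sub_apply]
  push_cast
  constructor <;> omega

/-- **From block sums to box sums**: `|Λ_L| ∑_{u ∈ Λ_L} G(u) ≤ ∑_{y,y' ∈ Λ_{2L}} G(y − y')` for
`G ≥ 0` (for `y ∈ Λ_L` the map `u ↦ y − u` sends `Λ_L` injectively into `Λ_{2L}`). -/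
theorem card_mul_box_sum_le_block {G : Site 3 → ℝ} (hG0 : ∀ u, 0 ≤ G u) (L : ℕ) :
    (#(box 3 L) : ℝ) * ∑ u ∈ box 3 L, G u ≤ ∑ y ∈ box 3 (2 * L), ∑ y' ∈ box 3 (2 * L), G (y - y') := by
  have hsub : box 3 L ⊆ box 3 (2 * L) := box_mono 3 (by omega)
  have hstep : ∀ y ∈ box 3 L, ∑ u ∈ box 3 L, G u ≤ ∑ y' ∈ box 3 (2 * L), G (y - y') := by
    intro y hy
    have hinj : ∀ a ∈ box 3 L, ∀ b ∈ box 3 L, y - a = y - b → a = b := fun a _ b _ h => by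
      simpa using h
    have e : ∑ y' ∈ (box 3 L).image (fun u => y - u), G (y - y') = ∑ u ∈ box 3 L, G u := by
      rw [Finset.sum_image hinj]
      refine Finset.sum_congr rfl fun u _ => ?_
      rw [sub_sub_cancel]
    rw [← e]
    refine Finset.sum_le_sum_of_subset_of_nonneg ?_ fun y' _ _ => hG0 _
    intro w hw
    obtain ⟨u, hu, rfl⟩ := Finset.mem_image.1 hw
    exact sub_mem_box_two_mul hy hu
  calc (#(box 3 L) : ℝ) * ∑ u ∈ box 3 L, G u = ∑ _y ∈ box 3 L, ∑ u ∈ box 3 L, G u := by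
        rw [Finset.sum_const, nsmul_eq_mul]
    _ ≤ ∑ y ∈ box 3 L, ∑ y' ∈ box 3 (2 * L), G (y - y') := Finset.sum_le_sum hstep
    _ ≤ ∑ y ∈ box 3 (2 * L), ∑ y' ∈ box 3 (2 * L), G (y - y') :=
        Finset.sum_le_sum_of_subset_of_nonneg hsub fun y _ _ => Finset.sum_nonneg fun y' _ => hG0 _

/-- **Block-sum upper bound** for the critical kernel under the Green package:
`∑_{y,y' ∈ Λ_m} G(y − y') ≤ K₁ (2m+1)^{5−η}`. -/
theorem block_sum_upper {η c : ℝ} (hη0 : 0 < η) (hη1 : η < 1) (hc : 0 < c)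
    {A₀ : ℝ} {b : Site 3 → ℝ} {P : ℕ → Site 3 → ℝ}
    (hA0 : 0 < A₀) (hb0 : ∀ y, 0 ≤ b y) (hbs : Summable b) (hbev : ∀ y, b (-y) = b y)
    (hbA : ∑' y, b y = A₀) (hblow : ∀ y, y ≠ 0 → c * ‖y‖ ^ (-(5 - η)) ≤ b y)
    (hP0 : ∀ z, P 0 z = if z = 0 then 1 else 0)
    (hPs : ∀ n z, P (n + 1) z = ∑' y, (b y / A₀) * P n (z - y))
    (hPnn : ∀ n z, 0 ≤ P n z) (hPsum : ∀ n, Summable (P n)) (hPn : ∀ z, Summable fun n => P n z)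
    (hG : ∀ z, criticalTwoPoint 3 z = A₀⁻¹ * ∑' n, P n z) :
    ∃ K₁ : ℝ, 0 < K₁ ∧ ∀ m : ℕ, ∑ y ∈ box 3 m, ∑ y' ∈ box 3 m, criticalTwoPoint 3 (y - y')
      ≤ K₁ * (2 * m + 1 : ℝ) ^ (5 - η) := by
  set α : ℝ := 2 - η with hα
  have hα0 : 0 < α := by rw [hα]; linarith
  have hα3 : α < (3 : ℕ) := by rw [hα]; push_cast; linarith
  have hπ := Real.pi_pos
  -- the step law `q = b / A₀`
  have hq0 : ∀ y, 0 ≤ b y / A₀ := fun y => div_nonneg (hb0 y) hA0.le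
  have hqs : Summable (fun y => b y / A₀) := hbs.div_const A₀
  have hq1' : ∑' y, b y / A₀ = 1 := by rw [tsum_div_const, hbA, div_self hA0.ne']
  have hq1 : ∑' y, b y / A₀ ≤ 1 := hq1'.le
  have hqev : ∀ y, b (-y) / A₀ = b y / A₀ := fun y => by rw [hbev]
  -- the symbol lower bound `1 − φ(k) ≥ c₁ ‖k‖^α`
  have hblow' : ∀ y : Site 3, y ≠ 0 → c * ‖y‖ ^ (-(((3 : ℕ) : ℝ) + α)) ≤ b y := by
    intro y hy
    have := hblow y hy
    rw [show -(5 - η) = -(((3 : ℕ) : ℝ) + α) by rw [hα]; push_cast; ring] at this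
    exact this
  set c₁ : ℝ := c * (2 * π) ^ (-α) / A₀ with hc₁
  have hc₁0 : 0 < c₁ := by positivity
  have hlow : ∀ k : Fin 3 → ℝ, ‖k‖ ≤ π → k ≠ 0 →
      c₁ * ‖k‖ ^ α ≤ 1 - ∑' y, b y / A₀ * Real.cos (phase 3 k y) := by
    intro k hk hk0
    have hψ := psi_lower (d := 3) (by norm_num) hc hα0 hb0 hbs hblow' hk hk0
    have hsc : Summable fun y => b y / A₀ * Real.cos (phase 3 k y) :=
      Summable.of_norm_bounded hqs fun y => by
        rw [Real.norm_eq_abs, abs_mul, abs_of_nonneg (hq0 y)]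
        exact mul_le_of_le_one_right (hq0 y) (Real.abs_cos_le_one _)
    have h1 : 1 - ∑' y, b y / A₀ * Real.cos (phase 3 k y)
        = A₀⁻¹ * ∑' y, b y * (1 - Real.cos (phase 3 k y)) := by
      calc 1 - ∑' y, b y / A₀ * Real.cos (phase 3 k y)
          = ∑' y, b y / A₀ - ∑' y, b y / A₀ * Real.cos (phase 3 k y) := by rw [hq1']
        _ = ∑' y, (b y / A₀ - b y / A₀ * Real.cos (phase 3 k y)) := (Summable.tsum_sub hqs hsc).symm
        _ = A₀⁻¹ * ∑' y, b y * (1 - Real.cos (phase 3 k y)) := by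
            rw [← tsum_mul_left]
            refine tsum_congr fun y => ?_
            rw [div_eq_mul_inv]
            ring
    rw [h1, hc₁]
    calc c * (2 * π) ^ (-α) / A₀ * ‖k‖ ^ α = A₀⁻¹ * (c * (2 * π) ^ (-α) * ‖k‖ ^ α) := by
          field_simp
      _ ≤ A₀⁻¹ * ∑' y, b y * (1 - Real.cos (phase 3 k y)) :=
          mul_le_mul_of_nonneg_left hψ (inv_nonneg.2 hA0.le)
  -- the integral constant
  set Cint : ℝ := (2 * π ^ (1 - α / (3 : ℕ)) * (1 / (1 - α / (3 : ℕ)) + 1 / (1 + α / (3 : ℕ)))) ^ (3 : ℕ)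
    with hCint
  have hs1 : α / (3 : ℕ) < 1 := by rw [div_lt_one (by norm_num)]; exact hα3
  have hCint0 : 0 < Cint := by
    have : 0 < 1 - α / (3 : ℕ) := by linarith
    positivity
  refine ⟨A₀⁻¹ * (2 / c₁ / (2 * π) ^ (3 : ℕ) * Cint), by positivity, fun m => ?_⟩
  obtain ⟨hI, hIle⟩ := integral_cube_weight_le (d := 3) (by norm_num) hα0 hα3 m
  have hbs_le := block_sum_green_le (d := 3) (by norm_num) hq0 hqs hq1 hqev hP0 hPs hPnn hPsum hPn
    hc₁0 hlow m hI
  have hGsum : ∑ y ∈ box 3 m, ∑ y' ∈ box 3 m, criticalTwoPoint 3 (y - y')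
      = A₀⁻¹ * ∑ y ∈ box 3 m, ∑ y' ∈ box 3 m, ∑' n, P n (y - y') := by
    rw [Finset.mul_sum]
    refine Finset.sum_congr rfl fun y _ => ?_
    rw [Finset.mul_sum]
    refine Finset.sum_congr rfl fun y' _ => ?_
    exact hG _
  rw [hGsum, show (5 - η) = ((3 : ℕ) : ℝ) + α by rw [hα]; push_cast; ring]
  rw [mul_assoc]
  refine mul_le_mul_of_nonneg_left ?_ (inv_nonneg.2 hA0.le)
  calc ∑ y ∈ box 3 m, ∑ y' ∈ box 3 m, ∑' n, P n (y - y')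
      ≤ 2 / c₁ / (2 * π) ^ (3 : ℕ) * ∫ k in Set.pi Set.univ (fun _ : Fin 3 => Set.Icc (-π) π),
          ‖k‖ ^ (-α) * ∑ y ∈ box 3 m, ∑ y' ∈ box 3 m, Real.cos (phase 3 k (y - y')) := hbs_le
    _ ≤ 2 / c₁ / (2 * π) ^ (3 : ℕ) * (Cint * (2 * m + 1 : ℝ) ^ (((3 : ℕ) : ℝ) + α)) :=
        mul_le_mul_of_nonneg_left hIle (by positivity)
    _ = 2 / c₁ / (2 * π) ^ (3 : ℕ) * Cint * (2 * m + 1 : ℝ) ^ (((3 : ℕ) : ℝ) + α) := by ring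

/-- **Box-sum upper bound**: `∑_{u ∈ Λ_L} G(u) ≤ K₂ L^{2−η}` for `L ≥ 1`. -/
theorem box_sum_upper {η K₁ : ℝ} (hη1 : η < 1) (hK₁ : 0 < K₁)
    (hblock : ∀ m : ℕ, ∑ y ∈ box 3 m, ∑ y' ∈ box 3 m, criticalTwoPoint 3 (y - y')
      ≤ K₁ * (2 * m + 1 : ℝ) ^ (5 - η))
    (hG0 : ∀ u, 0 ≤ criticalTwoPoint 3 u) {L : ℕ} (hL : 1 ≤ L) :
    ∑ u ∈ box 3 L, criticalTwoPoint 3 u ≤ 8 * K₁ * 5 ^ (2 - η) * (L : ℝ) ^ (2 - η) := by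
  have hL1 : (1 : ℝ) ≤ L := by exact_mod_cast hL
  have h1 := card_mul_box_sum_le_block hG0 L
  have h2 := hblock (2 * L)
  rw [card_box] at h1
  push_cast at h1 h2
  have hcard : (0 : ℝ) < (2 * L + 1) ^ 3 := by positivity
  have h3 : (2 * L + 1 : ℝ) ^ 3 * ∑ u ∈ box 3 L, criticalTwoPoint 3 u ≤ K₁ * (2 * (2 * L) + 1 : ℝ) ^ (5 - η) :=
    h1.trans h2
  -- `(4L+1)^{5-η} = (4L+1)^3 (4L+1)^{2-η} ≤ 8 (2L+1)^3 (5L)^{2-η}`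
  have h4 : (2 * (2 * L) + 1 : ℝ) ^ (5 - η) ≤ 8 * (2 * L + 1 : ℝ) ^ 3 * (5 ^ (2 - η) * (L : ℝ) ^ (2 - η)) := by
    have hpos : (0 : ℝ) < 2 * (2 * L) + 1 := by positivity
    rw [show (5 - η) = ((3 : ℕ) : ℝ) + (2 - η) by push_cast; ring, Real.rpow_add hpos, Real.rpow_natCast,
      ← Real.mul_rpow (by norm_num) (by positivity)]
    apply mul_le_mul _ _ (Real.rpow_nonneg hpos.le _) (by positivity)
    · nlinarith
    · exact Real.rpow_le_rpow hpos.le (by linarith) (by linarith)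
  have h5 : (2 * L + 1 : ℝ) ^ 3 * ∑ u ∈ box 3 L, criticalTwoPoint 3 u
      ≤ (2 * L + 1 : ℝ) ^ 3 * (8 * K₁ * 5 ^ (2 - η) * (L : ℝ) ^ (2 - η)) := by
    calc _ ≤ K₁ * (2 * (2 * L) + 1 : ℝ) ^ (5 - η) := h3
      _ ≤ K₁ * (8 * (2 * L + 1 : ℝ) ^ 3 * (5 ^ (2 - η) * (L : ℝ) ^ (2 - η))) :=
          mul_le_mul_of_nonneg_left h4 hK₁.le
      _ = (2 * L + 1 : ℝ) ^ 3 * (8 * K₁ * 5 ^ (2 - η) * (L : ℝ) ^ (2 - η)) := by ring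
  exact le_of_mul_le_mul_left h5 hcard

/-- **Pointwise upper bound** from the block-sum bound and Messager–Miracle-Solé. -/
theorem pointwise_upper {η K₁ : ℝ} (hη0 : 0 < η) (hη1 : η < 1) (hK₁ : 0 < K₁)
    (hblock : ∀ m : ℕ, ∑ y ∈ box 3 m, ∑ y' ∈ box 3 m, criticalTwoPoint 3 (y - y')
      ≤ K₁ * (2 * m + 1 : ℝ) ^ (5 - η))
    (hGle : ∀ u, criticalTwoPoint 3 u ≤ criticalTwoPoint 3 0) :
    ∃ C' : ℝ, ∀ z : Site 3, z ≠ 0 →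
      criticalTwoPoint 3 z ≤ C' * ‖z‖ ^ (-((3 : ℝ) - 2 + η)) := by
  set G := criticalTwoPoint 3 with hG
  have hG01 : criticalTwoPoint 3 0 = 1 := twoPointPlus_zero (d := 3) (criticalBeta 3)
  have hG00 : 0 ≤ G 0 := by rw [hG, hG01]; norm_num
  refine ⟨max (K₁ * 9 ^ ((3 : ℝ) - 2 + η)) (G 0 * 6 ^ ((3 : ℝ) - 2 + η)), fun z hz => ?_⟩
  set r : ℕ := Site.supNorm z with hr
  have hr1 : 1 ≤ r := Nat.one_le_iff_ne_zero.2 fun h => hz (Site.supNorm_eq_zero_iff.1 h)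
  have hnorm : ‖z‖ = r := Site.norm_eq_supNorm z
  have hrpos : (0 : ℝ) < r := by exact_mod_cast hr1
  have hexp : -((3 : ℝ) - 2 + η) < 0 := by linarith
  rw [hnorm]
  rcases lt_or_ge r 6 with hr6 | hr6
  · -- small `r`: `G z ≤ G 0 ≤ G0 · 6^{1+η} r^{-(1+η)}`
    have h1 : (6 : ℝ) ^ (-((3 : ℝ) - 2 + η)) ≤ (r : ℝ) ^ (-((3 : ℝ) - 2 + η)) :=
      Real.rpow_le_rpow_of_nonpos hrpos (by exact_mod_cast hr6.le) hexp.le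
    calc G z ≤ G 0 := hGle z
      _ = G 0 * 6 ^ ((3 : ℝ) - 2 + η) * (6 : ℝ) ^ (-((3 : ℝ) - 2 + η)) := by
          rw [Real.rpow_neg (by norm_num), mul_assoc, mul_inv_cancel₀ (by positivity), mul_one]
      _ ≤ G 0 * 6 ^ ((3 : ℝ) - 2 + η) * (r : ℝ) ^ (-((3 : ℝ) - 2 + η)) :=
          mul_le_mul_of_nonneg_left h1 (by positivity)
      _ ≤ max (K₁ * 9 ^ ((3 : ℝ) - 2 + η)) (G 0 * 6 ^ ((3 : ℝ) - 2 + η)) * (r : ℝ) ^ (-((3 : ℝ) - 2 + η)) :=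
          mul_le_mul_of_nonneg_right (le_max_right _ _) (Real.rpow_nonneg hrpos.le _)
  · -- large `r`: average over the block `Λ_{m'}`, `m' = r / 6`
    set m : ℕ := r / 6 with hm
    have hm1 : 1 ≤ m := Nat.le_div_iff_mul_le (by norm_num) |>.2 (by omega)
    have hm6 : 6 * m ≤ r := Nat.mul_div_le r 6
    have hmr : r < 6 * m + 6 := by omega
    have hmono : ∀ y ∈ box 3 m, ∀ y' ∈ box 3 m, G z ≤ G (y - y') := by
      intro y hy y' hy'
      refine criticalTwoPoint_le_of_supNorm ?_
      have := mem_box_iff_supNorm_le.1 (sub_mem_box_two_mul hy hy')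
      rw [← hr]; omega
    have h1 : ((#(box 3 m) : ℝ)) ^ 2 * G z ≤ ∑ y ∈ box 3 m, ∑ y' ∈ box 3 m, G (y - y') := by
      calc ((#(box 3 m) : ℝ)) ^ 2 * G z = ∑ y ∈ box 3 m, ∑ y' ∈ box 3 m, G z := by
            simp only [Finset.sum_const, nsmul_eq_mul]; ring
        _ ≤ _ := Finset.sum_le_sum fun y hy => Finset.sum_le_sum fun y' hy' => hmono y hy y' hy'
    have h2 := hblock m
    rw [card_box] at h1
    push_cast at h1
    have hM0 : (0 : ℝ) < 2 * m + 1 := by positivity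
    -- `G z ≤ K₁ (2m+1)^{5-η}/(2m+1)^6 = K₁ (2m+1)^{-(1+η)}`
    have h3 : G z ≤ K₁ * (2 * m + 1 : ℝ) ^ (-((3 : ℝ) - 2 + η)) := by
      have h4 : ((2 * m + 1 : ℝ) ^ 3) ^ 2 * G z ≤ K₁ * (2 * m + 1 : ℝ) ^ (5 - η) := h1.trans h2
      have h5 : (2 * m + 1 : ℝ) ^ (5 - η) = ((2 * m + 1 : ℝ) ^ 3) ^ 2 * (2 * m + 1 : ℝ) ^ (-((3 : ℝ) - 2 + η)) := by
        rw [← pow_mul, ← Real.rpow_natCast, ← Real.rpow_add hM0]; congr 1; push_cast; ring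
      rw [h5, mul_left_comm] at h4
      exact le_of_mul_le_mul_left h4 (by positivity)
    -- `(2m+1) ≥ r/9`, so `(2m+1)^{-(1+η)} ≤ (r/9)^{-(1+η)} = 9^{1+η} r^{-(1+η)}`
    have h6 : (r : ℝ) / 9 ≤ 2 * m + 1 := by
      rw [div_le_iff₀ (by norm_num)]
      have : (r : ℝ) < 6 * m + 6 := by exact_mod_cast hmr
      have : (3 : ℝ) ≤ r := by exact_mod_cast (show 3 ≤ r by omega)
      linarith
    have h7 : (2 * m + 1 : ℝ) ^ (-((3 : ℝ) - 2 + η)) ≤ ((r : ℝ) / 9) ^ (-((3 : ℝ) - 2 + η)) :=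
      Real.rpow_le_rpow_of_nonpos (by positivity) h6 hexp.le
    rw [Real.div_rpow hrpos.le (by norm_num), Real.rpow_neg (by norm_num : (0:ℝ) ≤ 9), div_inv_eq_mul] at h7
    calc G z ≤ K₁ * (2 * m + 1 : ℝ) ^ (-((3 : ℝ) - 2 + η)) := h3
      _ ≤ K₁ * ((r : ℝ) ^ (-((3 : ℝ) - 2 + η)) * 9 ^ ((3 : ℝ) - 2 + η)) := mul_le_mul_of_nonneg_left h7 hK₁.le
      _ = K₁ * 9 ^ ((3 : ℝ) - 2 + η) * (r : ℝ) ^ (-((3 : ℝ) - 2 + η)) := by ring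
      _ ≤ max (K₁ * 9 ^ ((3 : ℝ) - 2 + η)) (G 0 * 6 ^ ((3 : ℝ) - 2 + η)) * (r : ℝ) ^ (-((3 : ℝ) - 2 + η)) :=
          mul_le_mul_of_nonneg_right (le_max_left _ _) (Real.rpow_nonneg hrpos.le _)

/-- **Pointwise lower bound** from the test-function lower bound on box sums, the box-sum upper
bound and Messager–Miracle-Solé (annulus averaging). -/
theorem pointwise_lower {η Cs K₂ : ℝ} (hη0 : 0 < η) (hη1 : η < 1) (hCs : 0 < Cs) (hK₂ : 0 < K₂)
    (hlow : ∀ R : ℕ, 1 ≤ R → (R : ℝ) ^ (2 - η) / Cs ≤ ∑ u ∈ box 3 R, criticalTwoPoint 3 u)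
    (hup : ∀ L : ℕ, 1 ≤ L → ∑ u ∈ box 3 L, criticalTwoPoint 3 u ≤ K₂ * (L : ℝ) ^ (2 - η))
    (hG0 : ∀ u, 0 ≤ criticalTwoPoint 3 u) :
    ∃ c' : ℝ, 0 < c' ∧ ∀ z : Site 3, z ≠ 0 →
      c' * ‖z‖ ^ (-((3 : ℝ) - 2 + η)) ≤ criticalTwoPoint 3 z := by
  set G := criticalTwoPoint 3 with hG
  set α : ℝ := 2 - η with hα
  have hα0 : 0 < α := by rw [hα]; linarith
  -- the dilation factor `N` with `N^α ≥ 2 Cs K₂`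
  set N : ℕ := ⌈(2 * Cs * K₂) ^ (1 / α)⌉₊ + 1 with hN
  have hN1 : 1 ≤ N := by omega
  have hNpos : (0 : ℝ) < N := by exact_mod_cast hN1
  have hNα : 2 * Cs * K₂ ≤ (N : ℝ) ^ α := by
    have h1 : (2 * Cs * K₂) ^ (1 / α) ≤ N := by
      rw [hN]; push_cast
      exact (Nat.le_ceil _).trans (by linarith)
    have h2 := Real.rpow_le_rpow (by positivity) h1 hα0.le
    rwa [← Real.rpow_mul (by positivity), one_div_mul_cancel hα0.ne', Real.rpow_one] at h2
  refine ⟨K₂ * 3 ^ α / (27 * (3 * N) ^ 3), by positivity, fun z hz => ?_⟩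
  set r : ℕ := Site.supNorm z with hr
  have hr1 : 1 ≤ r := Nat.one_le_iff_ne_zero.2 fun h => hz (Site.supNorm_eq_zero_iff.1 h)
  have hnorm : ‖z‖ = r := Site.norm_eq_supNorm z
  have hrpos : (0 : ℝ) < r := by exact_mod_cast hr1
  set R : ℕ := 3 * r * N with hR
  have hR1 : 1 ≤ R := by rw [hR]; exact Nat.one_le_iff_ne_zero.2 (by positivity)
  have hsub : box 3 (3 * r - 1) ⊆ box 3 R := box_mono 3 (by
    rw [hR]
    calc 3 * r - 1 ≤ 3 * r := Nat.sub_le _ _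
      _ ≤ 3 * r * N := Nat.le_mul_of_pos_right _ (by omega))
  -- the annulus sum
  set A : Finset (Site 3) := box 3 R \ box 3 (3 * r - 1) with hA
  have hAsum : ∑ u ∈ A, G u = ∑ u ∈ box 3 R, G u - ∑ u ∈ box 3 (3 * r - 1), G u :=
    Finset.sum_sdiff_eq_sub hsub
  have h1 := hlow R hR1
  have h2 := hup (3 * r - 1) (by omega)
  have h3 : ((3 * r - 1 : ℕ) : ℝ) ^ α ≤ ((3 * r : ℕ) : ℝ) ^ α :=
    Real.rpow_le_rpow (Nat.cast_nonneg _) (by exact_mod_cast (Nat.sub_le _ _)) hα0.le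
  have hRα : (R : ℝ) ^ α = (N : ℝ) ^ α * ((3 * r : ℕ) : ℝ) ^ α := by
    rw [hR, ← Real.mul_rpow hNpos.le (Nat.cast_nonneg _)]; congr 1; push_cast; ring
  have hlowA : K₂ * ((3 * r : ℕ) : ℝ) ^ α ≤ ∑ u ∈ A, G u := by
    rw [hAsum]
    have h4 : (R : ℝ) ^ α / Cs ≥ 2 * K₂ * ((3 * r : ℕ) : ℝ) ^ α := by
      rw [ge_iff_le, le_div_iff₀ hCs, hRα]
      have := Real.rpow_nonneg (Nat.cast_nonneg (3 * r)) α
      nlinarith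
    have h5 : ∑ u ∈ box 3 (3 * r - 1), G u ≤ K₂ * ((3 * r : ℕ) : ℝ) ^ α :=
      h2.trans (mul_le_mul_of_nonneg_left h3 hK₂.le)
    rw [hα] at h1 h4 h5 ⊢
    linarith
  -- monotonicity on the annulus and averaging
  have hmono : ∀ w ∈ A, G w ≤ G z := by
    intro w hw
    rw [hA, Finset.mem_sdiff, mem_box_iff_supNorm_le, mem_box_iff_supNorm_le] at hw
    refine criticalTwoPoint_le_of_supNorm ?_
    rw [← hr]; omega
  have hcardA : (#A : ℝ) ≤ 27 * (R : ℝ) ^ 3 := by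
    have h6 : #A ≤ #(box 3 R) := Finset.card_le_card Finset.sdiff_subset
    rw [card_box] at h6
    have hR1' : (1 : ℝ) ≤ R := by exact_mod_cast hR1
    calc (#A : ℝ) ≤ ((2 * R + 1) ^ 3 : ℕ) := by exact_mod_cast h6
      _ = (2 * R + 1 : ℝ) ^ 3 := by push_cast; ring
      _ ≤ (3 * R : ℝ) ^ 3 := pow_le_pow_left₀ (by positivity) (by linarith) 3
      _ = 27 * (R : ℝ) ^ 3 := by ring
  have havg : ∑ u ∈ A, G u ≤ #A * G z := by
    calc ∑ u ∈ A, G u ≤ ∑ _u ∈ A, G z := Finset.sum_le_sum hmono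
      _ = #A * G z := by rw [Finset.sum_const, nsmul_eq_mul]
  have hGz : 0 ≤ G z := hG0 z
  have h7 : K₂ * ((3 * r : ℕ) : ℝ) ^ α ≤ 27 * (R : ℝ) ^ 3 * G z :=
    hlowA.trans (havg.trans (mul_le_mul_of_nonneg_right hcardA hGz))
  -- conclude
  rw [hnorm]
  have h8 : (R : ℝ) ^ 3 = (3 * N : ℝ) ^ 3 * (r : ℝ) ^ 3 := by rw [hR]; push_cast; ring
  have h9 : ((3 * r : ℕ) : ℝ) ^ α = 3 ^ α * (r : ℝ) ^ α := by
    push_cast; rw [Real.mul_rpow (by norm_num) hrpos.le]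
  rw [h8, h9] at h7
  have h10 : (r : ℝ) ^ (-((3 : ℝ) - 2 + η)) = (r : ℝ) ^ α / (r : ℝ) ^ 3 := by
    rw [show -((3 : ℝ) - 2 + η) = α - ((3 : ℕ) : ℝ) by rw [hα]; push_cast; ring, Real.rpow_sub hrpos,
      Real.rpow_natCast]
  rw [h10]
  have hr3 : (0 : ℝ) < (r : ℝ) ^ 3 := by positivity
  rw [mul_div_assoc', div_le_iff₀ hr3]
  calc K₂ * 3 ^ α / (27 * (3 * N) ^ 3) * (r : ℝ) ^ α
      = (K₂ * (3 ^ α * (r : ℝ) ^ α)) / (27 * (3 * N : ℝ) ^ 3) := by ring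
    _ ≤ (27 * ((3 * N : ℝ) ^ 3 * (r : ℝ) ^ 3) * G z) / (27 * (3 * N : ℝ) ^ 3) :=
        div_le_div_of_nonneg_right h7 (by positivity)
    _ = G z * (r : ℝ) ^ 3 := by field_simp

end Transfer

end Summit.CriticalPhenomena.Ising3DConformalLimit.Theorems.EtaBoundsTransfer
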